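import Summits.AtomisticToContinuum.BoseEinsteinCondensation.Theses.BECGroundStateSOS
import Literature.MathematicalPhysics.QuantumManyBody.PeriodicBoseGasFracEnergy
import Literature.MathematicalPhysics.QuantumManyBody.DiluteBoseGasUpperBoundLocalization
import Literature.MathematicalPhysics.QuantumManyBody.BoseGasThermodynamicLimitRuelle

/-!
# Route BECGroundStateSOS, support item `IRModeCounting` (stmt-AtomisticToContinuum-4246)

Closes `…Theses.BECGroundStateSOS.IRModeCounting` (`PeriodicEnergyFinite → PeriodicIRBound →
PeriodicBEC`, bodies inlined): the T = 0 infrared bound `n_k(Ψ) ≤ C√ρ L_N/‖k‖_∞` on the window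
`0 < ‖k‖_∞ ≤ κ√ρ L_N` (every `κ`) for near-minimisers of the periodic `N`-body energy on the torus
of side `L_N = (N/ρ)^{1/3}` implies condensation `⟨Ψ, n₀Ψ⟩ ≥ N/2` of the same near-minimisers
at all small densities. Proof (the item's sketch; architecture of [KLS1988PRL]):
* Parseval in the traced variable, `∑_k n_k = N`, and for the gradient,
  `∑_k |2πk/L|² n_k = ∫|∇Ψ|² ≤ ⟨Ψ,HΨ⟩` (tree: `PeriodicBoseGasFracEnergy`);
* the Dyson–LSSY upper bound `E₀^per ≤ 4πρ₁a(1 + C₁a/b)N ≤ AρN`, `A = 4πa(1 + C₁c₁)` (tree: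
  `LSSY2005_upperBound_periodic_holds`, `a < ∞` for finite range), so with `κ² = (A+1)/π²` and
  slack `δ ≤ ρN` the ultraviolet tail is `∑_{‖k‖_∞ > κ√ρL} n_k ≤ (E₀ + δ)/(4π²κ²ρ) ≤ N/4`;
* the lattice sum `∑_{0<‖k‖_∞≤M} 1/‖k‖_∞ ≤ 13M(M+1)` (shells of the cubes `{-M,…,M}³`), whence
  the infrared window carries at most `26Cκ²√ρ·N ≤ N/4` particles once `√ρ ≤ 1/(104Cκ²)`;
* hence `n₀ ≥ N − N/4 − N/4 = N/2` (`condensate_ge_half`, the counting step in abstract form).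
The hypothesis `PeriodicEnergyFinite` is not needed (the LSSY bound makes `E₀^per` finite).

## References

* [LSSY2005] Lieb, Seiringer, Solovej, Yngvason, *The Mathematics of the Bose Gas and its
  Condensation* (2005), Thm. 2.2 (2.14); §1.2 (1.17)–(1.19).
* [KLS1988PRL] Kennedy, Lieb, Shastry, Phys. Rev. Lett. 61 (1988) 2582 (IR bound ⇒ LRO).
-/

noncomputable section

open MeasureTheory Filter
open scoped ENNReal NNReal BigOperators

namespace Summit.AtomisticToContinuum.BoseEinsteinCondensation.Theorems

namespace ModeCounting

open Literature.MathematicalPhysics.QuantumManyBody.BoseGas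

/-! ## §1 Lattice bookkeeping: the cubes `{-M,…,M}³` and the harmonic shell sum -/

/-- The cube `{-M, …, M}³ ⊂ ℤ³` (closed sup-norm ball of radius `M ∈ ℕ`), as a `Finset`
(local notation, no new definition). -/
local notation "box[" M "]" =>
  (Fintype.piFinset fun _ : Fin 3 => Finset.Icc (-((M : ℕ) : ℤ)) ((M : ℕ) : ℤ) :
    Finset (Fin 3 → ℤ))

/-- The sup norm `‖k‖_∞` of `k ∈ ℤ³` (as a real vector; local notation). -/
local notation "ν[" k "]" => ‖(fun i : Fin 3 => (((k : Fin 3 → ℤ) i : ℤ) : ℝ))‖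

/-- Membership in the cube is `|k_j| ≤ M` for all `j`. [folklore] -/
theorem mem_latticeBox {M : ℕ} {k : Fin 3 → ℤ} : k ∈ box[M] ↔ ∀ j, |k j| ≤ M := by
  simp [Fintype.mem_piFinset, abs_le]

/-- `#{-M,…,M}³ = (2M+1)³`. [folklore] -/
theorem card_latticeBox (M : ℕ) : (box[M]).card = (2 * M + 1) ^ 3 := by
  rw [Fintype.card_piFinset, Finset.prod_const, Finset.card_univ, Fintype.card_fin,
    Int.card_Icc]
  congr 1
  omega

/-- The cubes increase. [folklore] -/
theorem latticeBox_mono {M M' : ℕ} (h : M ≤ M') : box[M] ⊆ box[M'] := fun k hk =>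
  mem_latticeBox.2 fun j => ((mem_latticeBox.1 hk) j).trans (by exact_mod_cast h)

/-- `0 ∈ {-M,…,M}³`. [folklore] -/
theorem zero_mem_latticeBox (M : ℕ) : (0 : Fin 3 → ℤ) ∈ box[M] :=
  mem_latticeBox.2 fun j => by simp

/-- The only point of the cube of radius `0` is `0`. [folklore] -/
theorem eq_zero_of_mem_latticeBox_zero {k : Fin 3 → ℤ} (hk : k ∈ box[0]) : k = 0 := by
  funext j
  simpa using (mem_latticeBox.1 hk) j

/-- Each coordinate is bounded by the sup norm: `|k_j| ≤ ‖k‖_∞`. [folklore] -/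
theorem abs_apply_le_norm (k : Fin 3 → ℤ) (j : Fin 3) : |(k j : ℝ)| ≤ ν[k] := by
  simpa [Real.norm_eq_abs] using norm_le_pi_norm (fun i => (k i : ℝ)) j

/-- Outside the cube of radius `M` the sup norm is at least `M + 1` (integrality). [folklore] -/
theorem succ_le_norm_of_not_mem_latticeBox {M : ℕ} {k : Fin 3 → ℤ} (hk : k ∉ box[M]) :
    (M : ℝ) + 1 ≤ ν[k] := by
  rw [mem_latticeBox] at hk
  push Not at hk
  obtain ⟨j, hj⟩ := hk
  have h2 : (M : ℝ) + 1 ≤ |(k j : ℝ)| := by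
    rw [← Int.cast_abs]
    exact_mod_cast (show (M : ℤ) + 1 ≤ |k j| from hj)
  exact h2.trans (abs_apply_le_norm k j)

/-- A lattice point of sup norm `≤ K` lies in the cube of radius `⌊K⌋₊`. [folklore] -/
theorem mem_latticeBox_floor_of_norm_le {K : ℝ} {k : Fin 3 → ℤ} (hk : ν[k] ≤ K) :
    k ∈ box[⌊K⌋₊] := by
  refine mem_latticeBox.2 fun j => ?_
  have h1 : (((k j).natAbs : ℕ) : ℝ) ≤ K := by
    rw [Nat.cast_natAbs, Int.cast_abs]
    exact (abs_apply_le_norm k j).trans hk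
  rw [Int.abs_eq_natAbs]
  exact_mod_cast Nat.le_floor h1

/-- **The harmonic shell sum** `∑_{0 < ‖k‖_∞ ≤ M} 1/‖k‖_∞ ≤ 13 M (M+1)` on `ℤ³` (the shell
`‖k‖_∞ = m` has `(2m+1)³ − (2m−1)³ = 24m² + 2 ≤ 26m²` points; induction on `M`). [folklore] -/
theorem sum_inv_norm_latticeShell_le (M : ℕ) :
    ∑ k ∈ (box[M]).erase 0, 1 / ν[k] ≤ 13 * M * (M + 1) := by
  classical
  induction M with
  | zero =>
    rw [Finset.sum_eq_zero fun k hk => ?_]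
    · simp
    · rw [Finset.mem_erase] at hk
      exact absurd (eq_zero_of_mem_latticeBox_zero hk.2) hk.1
  | succ M ih =>
    set s : Finset (Fin 3 → ℤ) := (box[M]).erase 0 with hs
    set t : Finset (Fin 3 → ℤ) := (box[M + 1]).erase 0 with ht
    have hsub : s ⊆ t := Finset.erase_subset_erase 0 (latticeBox_mono (Nat.le_succ M))
    rw [← Finset.sum_sdiff hsub]
    -- the new shell: each term is `≤ 1/(M+1)` and there are `(2M+3)³ - (2M+1)³` of them
    have hterm : ∀ k ∈ t \ s, 1 / ν[k] ≤ 1 / ((M : ℝ) + 1) := by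
      intro k hk
      have hk' : k ∉ box[M] := by
        simp only [Finset.mem_sdiff, ht, hs, Finset.mem_erase] at hk
        exact fun h => hk.2 ⟨hk.1.1, h⟩
      exact one_div_le_one_div_of_le (by positivity) (succ_le_norm_of_not_mem_latticeBox hk')
    have hcard : (((t \ s).card : ℕ) : ℝ) = (2 * (M + 1) + 1) ^ 3 - (2 * M + 1) ^ 3 := by
      have h1 := Finset.card_sdiff_add_card_eq_card hsub
      have h2 : s.card + 1 = (2 * M + 1) ^ 3 := by
        rw [hs, Finset.card_erase_add_one (zero_mem_latticeBox M), card_latticeBox]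
      have h3 : t.card + 1 = (2 * (M + 1) + 1) ^ 3 := by
        rw [ht, Finset.card_erase_add_one (zero_mem_latticeBox (M + 1)), card_latticeBox]
      have h4 : (t \ s).card + (2 * M + 1) ^ 3 = (2 * (M + 1) + 1) ^ 3 := by omega
      have h5 : (((t \ s).card : ℕ) : ℝ) + (2 * M + 1) ^ 3 = (2 * (M + 1) + 1) ^ 3 := by
        exact_mod_cast h4
      linarith
    have hshell : ∑ k ∈ t \ s, 1 / ν[k] ≤ 26 * ((M : ℝ) + 1) := by
      calc ∑ k ∈ t \ s, 1 / ν[k] ≤ ∑ _k ∈ t \ s, 1 / ((M : ℝ) + 1) := Finset.sum_le_sum hterm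
        _ = ((2 * (M + 1) + 1) ^ 3 - (2 * M + 1) ^ 3) * (1 / ((M : ℝ) + 1)) := by
            rw [Finset.sum_const, nsmul_eq_mul, hcard]
        _ = (24 * (M : ℝ) ^ 2 + 48 * M + 26) / ((M : ℝ) + 1) := by ring
        _ ≤ 26 * ((M : ℝ) + 1) := by
            rw [div_le_iff₀ (by positivity)]
            nlinarith [sq_nonneg (M : ℝ)]
    push_cast
    nlinarith [hshell, ih]

/-- The same bound in the form used below: `∑_{0 < ‖k‖_∞ ≤ M} 1/‖k‖_∞ ≤ 26 M²`. [folklore] -/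
theorem sum_inv_norm_latticeShell_le_sq (M : ℕ) :
    ∑ k ∈ (box[M]).erase 0, 1 / ν[k] ≤ 26 * (M : ℝ) ^ 2 := by
  refine (sum_inv_norm_latticeShell_le M).trans ?_
  rcases Nat.eq_zero_or_pos M with h | h
  · subst h; simp
  · have h1 : (1 : ℝ) ≤ M := by exact_mod_cast h
    nlinarith

/-- `‖k‖_∞² ≤ |k|₂² = ∑_j k_j²` on `ℤ³`. [folklore] -/
theorem norm_sq_le_sum_sq (k : Fin 3 → ℤ) : ν[k] ^ 2 ≤ ∑ j, (k j : ℝ) ^ 2 := by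
  have hsum : 0 ≤ ∑ j, (k j : ℝ) ^ 2 := Finset.sum_nonneg fun j _ => sq_nonneg _
  have h1 : ν[k] ≤ Real.sqrt (∑ j, (k j : ℝ) ^ 2) := by
    refine (pi_norm_le_iff_of_nonneg (Real.sqrt_nonneg _)).2 fun j => ?_
    rw [Real.norm_eq_abs, ← Real.sqrt_sq_eq_abs]
    exact Real.sqrt_le_sqrt
      (Finset.single_le_sum (fun i _ => sq_nonneg ((k i : ℝ))) (Finset.mem_univ j))
  calc ν[k] ^ 2 ≤ (Real.sqrt (∑ j, (k j : ℝ) ^ 2)) ^ 2 := by gcongr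
    _ = ∑ j, (k j : ℝ) ^ 2 := Real.sq_sqrt hsum

/-! ## §2 The counting step in abstract form -/

/-- **Mode counting on the torus (abstract form).** Let `Ψ` be a periodic `N`-body state on the
torus of side `L`, `n_k = ⟨φ_k, γ_Ψ φ_k⟩` its plane-wave occupations. Suppose (IR)
`n_k ≤ C_ir/‖k‖_∞` for `0 < ‖k‖_∞ ≤ K`; (UV) `D ≤ |2πk/L|²` for `‖k‖_∞ > K`, with
`D⁻¹⟨Ψ,HΨ⟩ ≤ N/4`; (window) `26 C_ir K² ≤ N/4`. Then `⟨Ψ, n₀Ψ⟩ ≥ N/2`, since by Parseval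
`N = ∑_k n_k ≤ n₀ + ∑_{IR} C_ir/‖k‖_∞ + D⁻¹∑_k|2πk/L|²n_k ≤ n₀ + 26 C_ir K² + D⁻¹⟨Ψ,HΨ⟩`.
[cite: LSSY2005, §1.2 (1.17)–(1.19)] -/
theorem condensate_ge_half {N : ℕ} {L K Cir : ℝ} (hL : 0 < L) (hK : 0 ≤ K) (hCir : 0 ≤ Cir)
    (v : ℝ → ℝ≥0∞) (Ψ : PeriodicTrialState N L) {D : ℝ≥0∞} (hD0 : D ≠ 0) (hDtop : D ≠ ⊤)
    (hIR : ∀ k : Fin 3 → ℤ, k ≠ 0 → ν[k] ≤ K →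
      cellOccupation N L (planeWaveMode L k) Ψ.ψ ≤ ENNReal.ofReal (Cir / ν[k]))
    (hUV : ∀ k : Fin 3 → ℤ, K < ν[k] → D ≤ fracDispersion 2 L k)
    (hT : D⁻¹ * periodicEnergy v Ψ ≤ ENNReal.ofReal (N / 4))
    (hW : Cir * (26 * K ^ 2) ≤ N / 4) :
    ENNReal.ofReal (1 / 2 * N) ≤ condensateOccupation N L Ψ.ψ := by
  classical
  set n : (Fin 3 → ℤ) → ℝ≥0∞ := fun k => cellOccupation N L (planeWaveMode L k) Ψ.ψ with hn
  set M : ℕ := ⌊K⌋₊ with hM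
  set S : Finset (Fin 3 → ℤ) := (box[M]).erase 0 with hS
  -- pointwise three-way bound: zero mode / infrared window / ultraviolet tail
  have hpt : ∀ k, n k ≤ (if k = 0 then n k else 0) +
      (if k ∈ S then ENNReal.ofReal (Cir / ν[k]) else 0) + D⁻¹ * (fracDispersion 2 L k * n k) := by
    intro k
    by_cases hk0 : k = 0
    · rw [if_pos hk0]
      exact le_add_right (le_add_right le_rfl)
    · by_cases hkK : ν[k] ≤ K
      · have hkS : k ∈ S := Finset.mem_erase.2 ⟨hk0, mem_latticeBox_floor_of_norm_le hkK⟩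
        rw [if_neg hk0, if_pos hkS, zero_add]
        exact le_add_right (hIR k hk0 hkK)
      · push Not at hkK
        refine le_add_left ?_
        calc n k = D⁻¹ * D * n k := by rw [ENNReal.inv_mul_cancel hD0 hDtop, one_mul]
          _ ≤ D⁻¹ * fracDispersion 2 L k * n k := by gcongr; exact hUV k hkK
          _ = D⁻¹ * (fracDispersion 2 L k * n k) := mul_assoc _ _ _
  -- the infrared window carries at most `N/4`
  have hIRsum : ∑ k ∈ S, ENNReal.ofReal (Cir / ν[k]) ≤ ENNReal.ofReal (N / 4) := by
    rw [← ENNReal.ofReal_sum_of_nonneg (fun k _ => by positivity)]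
    refine ENNReal.ofReal_le_ofReal ?_
    calc ∑ k ∈ S, Cir / ν[k] = Cir * ∑ k ∈ S, 1 / ν[k] := by
          rw [Finset.mul_sum]
          exact Finset.sum_congr rfl fun k _ => (mul_one_div _ _).symm
      _ ≤ Cir * (26 * (M : ℝ) ^ 2) := by gcongr; exact sum_inv_norm_latticeShell_le_sq M
      _ ≤ Cir * (26 * K ^ 2) := by gcongr; exact Nat.floor_le hK
      _ ≤ N / 4 := hW
  -- the ultraviolet tail carries at most `N/4`
  have hTsum : D⁻¹ * ∑' k, fracDispersion 2 L k * n k ≤ ENNReal.ofReal (N / 4) := by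
    refine le_trans ?_ hT
    gcongr
    calc ∑' k, fracDispersion 2 L k * n k = ∫⁻ X in cellN N L, kineticDensity Ψ.ψ X :=
          tsum_fracDispersion_two_mul_cellOccupation hL Ψ
      _ ≤ periodicEnergy v Ψ := lintegral_mono fun X => le_self_add
  -- Parseval and summation of the pointwise bound
  have hS' : ∑ k ∈ S, (if k ∈ S then ENNReal.ofReal (Cir / ν[k]) else 0) =
      ∑ k ∈ S, ENNReal.ofReal (Cir / ν[k]) :=
    Finset.sum_congr rfl fun k hk => if_pos hk
  have hsum : (N : ℝ≥0∞) ≤ n 0 + ENNReal.ofReal (N / 4) + ENNReal.ofReal (N / 4) := by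
    calc (N : ℝ≥0∞) = ∑' k, n k := (Ψ.tsum_cellOccupation_planeWaveMode hL).symm
      _ ≤ ∑' k, ((if k = 0 then n k else 0) + (if k ∈ S then ENNReal.ofReal (Cir / ν[k]) else 0)
          + D⁻¹ * (fracDispersion 2 L k * n k)) := ENNReal.tsum_le_tsum hpt
      _ = n 0 + ∑ k ∈ S, ENNReal.ofReal (Cir / ν[k]) +
          D⁻¹ * ∑' k, fracDispersion 2 L k * n k := by
          rw [ENNReal.tsum_add, ENNReal.tsum_add, tsum_ite_eq 0 n, ENNReal.tsum_mul_left,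
            tsum_eq_sum (s := S) fun k hk => if_neg hk, hS']
      _ ≤ n 0 + ENNReal.ofReal (N / 4) + ENNReal.ofReal (N / 4) := by gcongr
  -- conclusion: `N/2 + N/2 ≤ n₀ + N/2`
  have h2 : ENNReal.ofReal (1 / 2 * N) + ENNReal.ofReal (1 / 2 * N) = (N : ℝ≥0∞) := by
    rw [← ENNReal.ofReal_add (by positivity) (by positivity), ← ENNReal.ofReal_natCast]
    exact congrArg ENNReal.ofReal (by ring)
  have h4 : ENNReal.ofReal ((N : ℝ) / 4) + ENNReal.ofReal ((N : ℝ) / 4) =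
      ENNReal.ofReal (1 / 2 * N) := by
    rw [← ENNReal.ofReal_add (by positivity) (by positivity)]
    exact congrArg ENNReal.ofReal (by ring)
  have hhalf : ENNReal.ofReal (1 / 2 * N) + ENNReal.ofReal (1 / 2 * N) ≤
      n 0 + ENNReal.ofReal (1 / 2 * N) := by
    rw [h2, ← h4, ← add_assoc]
    exact hsum
  have h0 : n 0 = condensateOccupation N L Ψ.ψ := cellOccupation_planeWaveMode_zero N L Ψ.ψ
  rw [← h0]
  exact ENNReal.le_of_add_le_add_right ENNReal.ofReal_ne_top hhalf

end ModeCounting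

/-! ## §3 The route item -/

open Literature.MathematicalPhysics.QuantumManyBody.BoseGas
open Summit.AtomisticToContinuum.BoseEinsteinCondensation.Theses.BECGroundStateSOS
open ModeCounting

/-- **Mode counting on the torus** (route BECGroundStateSOS, item `IRModeCounting`,
stmt-AtomisticToContinuum-4246): finiteness of the periodic ground-state energy (not used) and
the T = 0 infrared bound `n_k(Ψ) ≤ C√ρL_N/‖k‖_∞` on the window `0 < ‖k‖_∞ ≤ κ√ρL_N` for
near-minimisers (for every `κ`) imply, for every repulsive finite-range `v` and all small `ρ`,
condensation `⟨Ψ, n₀Ψ⟩ ≥ N/2` of the `δ_N`-near-minimisers on the torus of side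
`L_N = (N/ρ)^{1/3}`, eventually in `N`. Constants: `κ² = (A+1)/π²` with `A = 4πa(1 + C₁c₁)` from
LSSY Thm. 2.2 (UV tail `≤ N/4` by the kinetic Markov bound with slack `δ_N ≤ ρN`),
`√ρ < 1/(104 C κ²)` (IR window `≤ N/4` by the shell sum), and `ρ` below the LSSY threshold
`(a+1)(4πρ/3)^{1/3} < c₁`. [cite: LSSY2005, Thm. 2.2 (2.14) and §1.2 (1.17)–(1.19)] -/
theorem IRModeCounting_proof : IRModeCounting := by
  intro _hF hX v hv
  -- constants attached to `v`: range, scattering length, the LSSY upper bound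
  obtain ⟨R, hR, hvR⟩ := hv.exists_pos_range
  obtain ⟨C₁, c₁, hC₁, hc₁, hLSSY⟩ :=
    LSSY2005_upperBound_periodic_holds v R hv.1 hvR hv.scatteringLength_ne_top
  set a : ℝ := (scatteringLength v).toReal with ha
  have ha0 : 0 ≤ a := ENNReal.toReal_nonneg
  set A : ℝ := 4 * Real.pi * a * (1 + C₁ * c₁) with hA
  have hA0 : 0 ≤ A := by positivity
  set κ : ℝ := Real.sqrt (A + 1) / Real.pi with hκ
  have hκ0 : 0 < κ := by positivity
  have hκ2 : Real.pi ^ 2 * κ ^ 2 = A + 1 := by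
    rw [hκ, div_pow, Real.sq_sqrt (by positivity)]
    field_simp
  obtain ⟨ρX, hρX, C, hC, hXv⟩ := hX v hv κ hκ0
  -- density thresholds
  set ρa : ℝ := 3 * (c₁ / (a + 1)) ^ 3 / (4 * Real.pi) with hρa
  have hρa0 : 0 < ρa := by positivity
  set ρC : ℝ := (1 / (104 * C * κ ^ 2)) ^ 2 with hρC
  have hρC0 : 0 < ρC := by positivity
  refine ⟨min ρX (min ρa ρC), lt_min hρX (lt_min hρa0 hρC0), fun ρ hρ hρ₀ => ?_⟩
  have hρX' : ρ < ρX := lt_of_lt_of_le hρ₀ (min_le_left _ _)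
  have hρa' : ρ < ρa := lt_of_lt_of_le hρ₀ ((min_le_right _ _).trans (min_le_left _ _))
  have hρC' : ρ < ρC := lt_of_lt_of_le hρ₀ ((min_le_right _ _).trans (min_le_right _ _))
  -- consequences of the thresholds
  have hsmall : (a + 1) * (4 * Real.pi * ρ / 3) ^ ((1 : ℝ) / 3) < c₁ := by
    have h1 : 4 * Real.pi * ρ / 3 < (c₁ / (a + 1)) ^ 3 := by
      rw [hρa, lt_div_iff₀ (by positivity)] at hρa'
      rw [div_lt_iff₀ (by norm_num : (0 : ℝ) < 3)]
      linarith
    have h2 : (4 * Real.pi * ρ / 3) ^ ((1 : ℝ) / 3) < c₁ / (a + 1) := by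
      calc (4 * Real.pi * ρ / 3) ^ ((1 : ℝ) / 3) < ((c₁ / (a + 1)) ^ 3) ^ ((1 : ℝ) / 3) :=
            Real.rpow_lt_rpow (by positivity) h1 (by norm_num)
        _ = c₁ / (a + 1) := by
            rw [show ((1 : ℝ) / 3) = ((3 : ℕ) : ℝ)⁻¹ by norm_num,
              Real.pow_rpow_inv_natCast (by positivity) (by norm_num)]
    calc (a + 1) * (4 * Real.pi * ρ / 3) ^ ((1 : ℝ) / 3) < (a + 1) * (c₁ / (a + 1)) := by
          gcongr
      _ = c₁ := by field_simp
  have hsqrtρ : 104 * C * κ ^ 2 * Real.sqrt ρ ≤ 1 := by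
    have h1 : Real.sqrt ρ < 1 / (104 * C * κ ^ 2) := by
      calc Real.sqrt ρ < Real.sqrt ρC := Real.sqrt_lt_sqrt hρ.le hρC'
        _ = 1 / (104 * C * κ ^ 2) := by rw [hρC, Real.sqrt_sq (by positivity)]
    rw [lt_div_iff₀ (by positivity)] at h1
    linarith
  -- the answer: `c = 1/2`, eventually in `N`
  refine ⟨1 / 2, by norm_num, ?_⟩
  filter_upwards [hXv ρ hρ hρX', eventually_ge_atTop 2,
    (tendsto_sideLength_atTop hρ).eventually_gt_atTop (2 * R)] with N ⟨δX, hδX, hXN⟩ hN2 hRL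
  have hN : 0 < N := lt_of_lt_of_le two_pos hN2
  have hNr : (0 : ℝ) < N := Nat.cast_pos.2 hN
  set L : ℝ := sideLength ρ N with hLdef
  have hL : 0 < L := Real.rpow_pos_of_pos (div_pos hNr hρ) _
  have hL3 : ρ * L ^ 3 = N := by
    rw [hLdef, sideLength_pow_three hρ N]
    field_simp
  -- the energy bound `E₀^per ≤ A ρ N` (LSSY Thm. 2.2 with `ρ₁ ≤ ρ`, `a/b ≤ c₁`)
  have hE0 : periodicGroundStateEnergy v N L ≤ ENNReal.ofReal (A * ρ * N) := by
    have hL1 := hLSSY N L hN2 hL hRL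
    simp only [] at hL1
    set ρ₁ : ℝ := ((N : ℝ) - 1) / L ^ 3 with hρ₁
    have hN2r : (2 : ℝ) ≤ N := by exact_mod_cast hN2
    have hρ₁0 : 0 ≤ ρ₁ := div_nonneg (by linarith) (by positivity)
    have hρ₁ρ : ρ₁ ≤ ρ := by
      rw [hρ₁, div_le_iff₀ (by positivity), hL3]
      linarith
    have hx : a * (4 * Real.pi * ρ₁ / 3) ^ ((1 : ℝ) / 3) ≤ c₁ := by
      have h1 : (4 * Real.pi * ρ₁ / 3) ^ ((1 : ℝ) / 3) ≤ (4 * Real.pi * ρ / 3) ^ ((1 : ℝ) / 3) :=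
        Real.rpow_le_rpow (by positivity) (by gcongr) (by norm_num)
      calc a * (4 * Real.pi * ρ₁ / 3) ^ ((1 : ℝ) / 3)
          ≤ (a + 1) * (4 * Real.pi * ρ / 3) ^ ((1 : ℝ) / 3) :=
            mul_le_mul (by linarith) h1 (by positivity) (by positivity)
        _ ≤ c₁ := hsmall.le
    have hL2 := hL1 (by rw [div_rpow_neg_third (by positivity)]; exact hx)
    rw [div_rpow_neg_third (by positivity)] at hL2
    refine hL2.trans (ENNReal.ofReal_le_ofReal ?_)
    rw [hA]
    calc 4 * Real.pi * ρ₁ * a * (1 + C₁ * (a * (4 * Real.pi * ρ₁ / 3) ^ ((1 : ℝ) / 3))) * N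
        ≤ 4 * Real.pi * ρ * a * (1 + C₁ * c₁) * N := by gcongr
      _ = 4 * Real.pi * a * (1 + C₁ * c₁) * ρ * N := by ring
  -- the slack `δ_N = min(δ_X, ρN)`
  refine ⟨min δX (ENNReal.ofReal (ρ * N)), lt_min hδX (ENNReal.ofReal_pos.2 (by positivity)), ?_⟩
  intro Ψ hΨ
  have hΨX : periodicEnergy v Ψ ≤ periodicGroundStateEnergy v N L + δX :=
    hΨ.trans (add_le_add le_rfl (min_le_left _ _))
  have hΨE : periodicEnergy v Ψ ≤ ENNReal.ofReal ((A + 1) * ρ * N) := by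
    calc periodicEnergy v Ψ ≤ periodicGroundStateEnergy v N L + ENNReal.ofReal (ρ * N) :=
          hΨ.trans (add_le_add le_rfl (min_le_right _ _))
      _ ≤ ENNReal.ofReal (A * ρ * N) + ENNReal.ofReal (ρ * N) := add_le_add hE0 le_rfl
      _ = ENNReal.ofReal ((A + 1) * ρ * N) := by
          rw [← ENNReal.ofReal_add (by positivity) (by positivity)]
          exact congrArg ENNReal.ofReal (by ring)
  -- the counting step with `K = κ√ρL`, `C_ir = C√ρL`, `D = 4π²κ²ρ`
  set D : ℝ≥0∞ := ENNReal.ofReal (4 * Real.pi ^ 2 * κ ^ 2 * ρ) with hD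
  have hDpos : 0 < 4 * Real.pi ^ 2 * κ ^ 2 * ρ := by positivity
  have hD0 : D ≠ 0 := (ENNReal.ofReal_pos.2 hDpos).ne'
  refine condensate_ge_half hL (K := κ * Real.sqrt ρ * L) (Cir := C * Real.sqrt ρ * L)
    (by positivity) (by positivity) v Ψ hD0 ENNReal.ofReal_ne_top ?_ ?_ ?_ ?_
  · -- (IR) the hypothesis `X`
    intro k hk0 hkK
    have hm : (fun x => ((Real.sqrt (L ^ 3))⁻¹ : ℂ) * cellWave L k x) = planeWaveMode L k :=
      funext fun x => (planeWaveMode_eq L k x).symm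
    have h := hXN Ψ hΨX k hk0 hkK
    rwa [hm] at h
  · -- (UV) `4π²κ²ρ ≤ |2πk/L|²` off the window (`‖k‖_∞² ≤ |k|₂²`)
    intro k hk
    rw [hD, fracDispersion_two]
    refine ENNReal.ofReal_le_ofReal ?_
    have h1 : (κ * Real.sqrt ρ * L) ^ 2 < ∑ j, (k j : ℝ) ^ 2 := by
      calc (κ * Real.sqrt ρ * L) ^ 2 < ‖(fun i => (k i : ℝ))‖ ^ 2 := by gcongr
        _ ≤ ∑ j, (k j : ℝ) ^ 2 := norm_sq_le_sum_sq k
    rw [mul_pow, mul_pow, Real.sq_sqrt hρ.le] at h1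
    rw [le_div_iff₀ (by positivity)]
    calc 4 * Real.pi ^ 2 * κ ^ 2 * ρ * L ^ 2 = 4 * Real.pi ^ 2 * (κ ^ 2 * ρ * L ^ 2) := by ring
      _ ≤ 4 * Real.pi ^ 2 * ∑ j, (k j : ℝ) ^ 2 := by gcongr
  · -- (T) `(E₀ + δ)/(4π²κ²ρ) ≤ (A+1)ρN/(4(A+1)ρ) = N/4`
    calc D⁻¹ * periodicEnergy v Ψ ≤ D⁻¹ * ENNReal.ofReal ((A + 1) * ρ * N) := by gcongr
      _ = ENNReal.ofReal ((A + 1) * ρ * N / (4 * Real.pi ^ 2 * κ ^ 2 * ρ)) := by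
          rw [← ENNReal.div_eq_inv_mul, hD, ← ENNReal.ofReal_div_of_pos hDpos]
      _ = ENNReal.ofReal (N / 4) := by
          congr 1
          rw [show 4 * Real.pi ^ 2 * κ ^ 2 * ρ = 4 * (Real.pi ^ 2 * κ ^ 2) * ρ by ring, hκ2]
          field_simp
  · -- (window) `C√ρL · 26 κ²ρL² = 26Cκ²√ρ·N ≤ N/4`
    have h1 : C * Real.sqrt ρ * L * (26 * (κ * Real.sqrt ρ * L) ^ 2) =
        26 * C * κ ^ 2 * Real.sqrt ρ * (ρ * L ^ 3) := by
      rw [mul_pow, mul_pow, Real.sq_sqrt hρ.le]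
      ring
    rw [h1, hL3]
    nlinarith [hsqrtρ, hNr.le]

end Summit.AtomisticToContinuum.BoseEinsteinCondensation.Theorems
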